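import Literature.Computability.Cryptography.ShiftSamplingUniform
import Literature.NumberTheory.QuadraticFields.RealQuadraticInfrastructureDistance
import Mathlib.Data.Nat.Size
import HarnessLib

/-!
# The parameters of the shift experiment and of the walk in Hallgren's regulator algorithm, as functions of the input length

Topic `Computability/Cryptography`; preparation for the assembly of
`Hallgren2007_regulator_qsolvable_delim` (`HallgrenPell.lean`) from the quantum core
`ShiftSampling*.lean` and the walk of `InfrastructureNavigation.lean`. Every parameter of the
algorithm — grid `N = 2^{a(n)}`, transform size `Q = 2^{L(n)}`, levels, repetitions, units, and the
walk's start-up, doubling depth, final rounds and precision — is an explicit polynomial (or a power of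
two of a polynomial) of the input LENGTH `n`, as the uniformity of the family requires; this file
fixes them (with generous constants; Jozsa 2003, §9–§10 leaves them as "poly(log d)") and proves the
inequalities the assembly needs. Theorem-and-definition file, no named facts.

* the shift-experiment shape `hallgrenSS : SSParams` (`nUnits = 2^44` units — `2^43` disjoint pairs —,
  `L(n) = 8n + 42`, `Lv = L + 1`, `Brep = 256 (L + 1)`), its `CodeFP` sizes and its counter
  expressions `hallgrenGE : GEParams hallgrenSS`;
* the walk parameters `aN`, `Kb`, `Gb`, `s0`, `Tdbl`, `ResB`, `Mfin`, `precP` and the bounds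
  `size_le_of_lt_two_pow`, `log_four_le`, `Kq_nat_le_Kb`, **`prec_key`**
  (`2^{a} (T 2^{T}(s₀+1) + T + 2M + 3)(n + 10) ≤ 2 · 2^{prec}`, i.e. `N (E_tot + 2η) ≤ 2`);
* the size of the principal cycle: `minimalPeriod_le_card_reducedSet`, `card_reducedSet_le`,
  **`periodLength_le_three_mul`** (`p ≤ 3D`), **`log_fundUnit_lt`** (`R < 3D(D+1)`) and
  **`log_fundUnit_gt_third`** (`R > 1/3`, two consecutive gaps exceed `ln 2`).

## References

* R. Jozsa, arXiv:quant-ph/0302134 (2003), §6.3 Prop. 30, §7 Props. 31–32, §9 Thm. 5, §10 Thm. 6.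
  [Jozsa2003]
* M. J. Jacobson, Jr., H. C. Williams, *Solving the Pell Equation*, Springer (2009), §3.3 (3.32).
  [JacobsonWilliams2008]
-/

noncomputable section

namespace Literature.Computability.Cryptography

namespace HallgrenQuantum

open _root_.Computability Complexity Complexity.CodeFP QuantumComplexity QuantumComplexity.RevDesc ShiftSampling
  Literature.NumberTheory.QuadraticFields Literature.NumberTheory.QuadraticFields.QuadIrr Finset

/-! ### The shape of the shift experiment -/

/-- The grid exponent: `N = 2^{a(n)}`, `a(n) = 2n + 12`. [cite: Jozsa2003, §10 Prop. 36 (iii) (N > log d / d_min)] -/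
def aN (n : ℕ) : ℕ := 2 * n + 12
/-- The transform exponent: `Q = 2^{L(n)}`, `L(n) = 8n + 42` (so that `Q ≥ 3S²`). [cite: Jozsa2003, §10 Thm. 6 (q ≥ 3S²)] -/
def LQ (n : ℕ) : ℕ := 8 * n + 42
/-- Levels: `L + 1` (so that `Q ≤ 2^{Lv−1}`). [cite: Kitaev1995, §3 Thm 1] -/
def LvQ (n : ℕ) : ℕ := LQ n + 1
/-- Repetitions per test: `256 (L + 1)` (accuracy defect `≤ 1/2`). [cite: Kitaev1995, §3 (before Lemma 9)] -/
def Brep (n : ℕ) : ℕ := 256 * (LQ n + 1)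
/-- Units: `2^44` (i.e. `2^43` disjoint pairs of Fourier samples). [cite: Jozsa2003, §10 (repetition)] -/
def nUnits (_n : ℕ) : ℕ := 2 ^ 44

/-- **The shape of Hallgren's shift experiment.** [cite: Jozsa2003, §10 (proof of Thm. 6)] -/
def hallgrenSS : SSParams where
  nU := nUnits
  L := LQ
  Lv := LvQ
  B := Brep
  nU_pos := fun _ => by unfold nUnits; positivity
  L_pos := fun _ => by unfold LQ; omega
  Lv_pos := fun _ => by unfold LvQ; omega
  B_pos := fun _ => by unfold Brep; omega
  nU_mono := fun _ _ _ => le_rfl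
  L_mono := fun _ _ h => by unfold LQ; omega
  Lv_mono := fun _ _ h => by unfold LvQ LQ; omega
  B_mono := fun _ _ h => by unfold Brep LQ; omega

/-- Unary multiplication by a constant (a private copy of `CodeFPStrings.unMulConst`). [folklore] -/
private theorem unMulConst' : ∀ c : ℕ, CodeFP unE unE (fun n => c * n)
  | 0 => (const unE 0).congr fun n => by simp
  | c + 1 => (unAdd.comp ((unMulConst' c).pair (CodeFP.id unE))).congr fun n => by simp [add_mul]

/-- `nU` in unary (a constant). [folklore] -/
theorem nU_un : CodeFP unE unE hallgrenSS.nU := (const unE (2 ^ 44)).congr fun _ => rfl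
/-- `L` in unary. [folklore] -/
theorem L_un : CodeFP unE unE hallgrenSS.L :=
  ((unAdd.comp ((unMulConst' 8).pair (const unE 42))) :).congr fun _ => rfl
/-- `Lv` in unary. [folklore] -/
theorem Lv_un : CodeFP unE unE hallgrenSS.Lv := ((unSucc.comp L_un) :).congr fun _ => rfl
/-- `B` in unary. [folklore] -/
theorem B_un : CodeFP unE unE hallgrenSS.B := (((unMulConst' 256).comp (unSucc.comp L_un)) :).congr fun _ => rfl

/-- **The parameters as counter expressions** (for `family_isUniform`). [cite: AroraBarak2009, §6.2 Def. 6.12] -/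
def hallgrenGE : hallgrenSS.GEParams where
  nUE := .const (2 ^ 44)
  LE := .add (.mul (.const 8) (.var .uu)) (.const 42)
  LvE := .add (.add (.mul (.const 8) (.var .uu)) (.const 42)) (.const 1)
  BE := .mul (.const 256) (.add (.add (.mul (.const 8) (.var .uu)) (.const 42)) (.const 1))
  eval_nUE := fun _ => rfl
  eval_LE := fun _ => rfl
  eval_LvE := fun _ => rfl
  eval_BE := fun _ => rfl
  fv_nUE := fun x hx => by simp [GExpr.fv] at hx
  fv_LE := fun x hx => by simp [GExpr.fv] at hx; exact hx
  fv_LvE := fun x hx => by simp [GExpr.fv] at hx; exact hx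
  fv_BE := fun x hx => by simp [GExpr.fv] at hx; exact hx

/-! ### The walk parameters -/

/-- The bound `Kb(n) ≥ K` on the defect bound of the giant step (`K = Ks (2 size D + 3) + size D`,
`Ks = log₄(2D) + 3`, `D < 2^{n+3}`). [cite: Jozsa2003, §7.1 Prop. 35] -/
def Kb (n : ℕ) : ℕ := (n + 7) * (2 * n + 9) + n + 3
/-- The bound `Gb(n) ≥ G = 1 + size D` on the gaps. [cite: Jozsa2003, §7 Prop. 31] -/
def Gb (n : ℕ) : ℕ := n + 4
/-- Start-up rounds. [cite: Jozsa2003, §9 (proof of Thm. 5)] -/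
def s0 (n : ℕ) : ℕ := 12 * Kb n + 6
/-- Doubling depth `T = L − a + 1`. [cite: Jozsa2003, §9 (proof of Thm. 5: N < ⌈log₂(x/A)⌉)] -/
def Tdbl (n : ℕ) : ℕ := LQ n - aN n + 1
/-- The residual bound `(2T + 3)(Kb + 1) + Gb + 1 ≥ Res`. [cite: Jozsa2003, §9] -/
def ResB (n : ℕ) : ℕ := (2 * Tdbl n + 3) * (Kb n + 1) + Gb n + 1
/-- Half the number of final rounds: `M = 3 ResB` (`M (ln 2 − 2η) > Res`). [cite: Jozsa2003, §9] -/
def Mfin (n : ℕ) : ℕ := 3 * ResB n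
/-- Precision `prec = 9n + 75` (`η = (Ks + 3) 2^{−prec}`, so that `N (E_tot + 2η) ≤ 2`). [cite: Jozsa2003, §9 Thm. 5 ("to a sufficient accuracy")] -/
def precP (n : ℕ) : ℕ := 9 * n + 75

/-- `Tdbl n = 6n + 31`. [folklore] -/
theorem Tdbl_eq (n : ℕ) : Tdbl n = 6 * n + 31 := by unfold Tdbl LQ aN; omega

/-- `precP + 1 = aN + Tdbl + (n + 33)`. [folklore] -/
theorem precP_eq (n : ℕ) : precP n + 1 = aN n + Tdbl n + (n + 33) := by rw [Tdbl_eq]; unfold precP aN; omega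

/-! ### Arithmetic of sizes -/

/-- `size D ≤ n + 3` for `D < 2^{n+3}`. [folklore] -/
theorem size_le_of_lt_two_pow {D n : ℕ} (h : D < 2 ^ (n + 3)) : Nat.size D ≤ n + 3 := Nat.size_le.2 h

/-- `log₄ (2D) + 3 ≤ n + 7` for `D < 2^{n+3}`. [folklore] -/
theorem log_four_le {D n : ℕ} (h : D < 2 ^ (n + 3)) : Nat.log 4 (2 * D) + 3 ≤ n + 7 := by
  have h1 : Nat.log 4 (2 * D) ≤ Nat.log 2 (2 * D) := Nat.log_anti_left (by norm_num) (by norm_num)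
  have h2 : Nat.log 2 (2 * D) < n + 4 := by
    rcases Nat.eq_zero_or_pos D with rfl | hD
    · simp
    · exact Nat.log_lt_of_lt_pow (by omega) (by rw [pow_succ]; omega)
  omega

/-- **`K ≤ Kb(n)`**: `(log₄(2D) + 3)(2 size D + 3) + size D ≤ Kb n` for `D < 2^{n+3}`. [folklore] -/
theorem Kq_nat_le_Kb {D n : ℕ} (h : D < 2 ^ (n + 3)) :
    (Nat.log 4 (2 * D) + 3) * (2 * Nat.size D + 3) + Nat.size D ≤ Kb n := by
  have h1 := log_four_le h
  have h2 := size_le_of_lt_two_pow h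
  unfold Kb
  calc (Nat.log 4 (2 * D) + 3) * (2 * Nat.size D + 3) + Nat.size D
      ≤ (n + 7) * (2 * (n + 3) + 3) + (n + 3) := by gcongr
    _ = (n + 7) * (2 * n + 9) + n + 3 := by ring

/-- `1 + size D ≤ Gb n` for `D < 2^{n+3}`. [folklore] -/
theorem G_le_Gb {D n : ℕ} (h : D < 2 ^ (n + 3)) : 1 + Nat.size D ≤ Gb n := by
  have := size_le_of_lt_two_pow h; unfold Gb; omega

/-- `Ks + 3 ≤ n + 10` for `D < 2^{n+3}` (`Ks = log₄(2D) + 3`). [folklore] -/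
theorem Ks_add_three_le {D n : ℕ} (h : D < 2 ^ (n + 3)) : Nat.log 4 (2 * D) + 3 + 3 ≤ n + 10 := by
  have := log_four_le h; omega

/-- `size (Ks + 3) + 3 ≤ prec` (the hypothesis of `etaR_le`). [folklore] -/
theorem size_Ks_le_prec {D n : ℕ} (h : D < 2 ^ (n + 3)) : Nat.size (Nat.log 4 (2 * D) + 3 + 3) + 3 ≤ precP n := by
  have h1 := log_four_le h
  have h2 : Nat.size (Nat.log 4 (2 * D) + 3 + 3) ≤ Nat.size (n + 10) := Nat.size_le_size (by omega)
  have h3 : Nat.size (n + 10) ≤ n + 10 := Nat.size_le.2 (Nat.lt_two_pow_self)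
  unfold precP; omega

/-- A quintic is eventually below a shifted power of two: `54000 (n + 10)^5 ≤ 2^{n+33}`. [folklore] -/
theorem quintic_le_two_pow (n : ℕ) : 54000 * (n + 10) ^ 5 ≤ 2 ^ (n + 33) := by
  induction n with
  | zero => norm_num
  | succ n ih =>
    have hstep : (n + 1 + 10) ^ 5 ≤ 2 * (n + 10) ^ 5 := by
      have h2 : 10 * (n + 11) ^ 2 ≤ 13 * (n + 10) ^ 2 := by ring_nf; nlinarith [sq_nonneg n]
      have h4 : 100 * (n + 11) ^ 4 ≤ 169 * (n + 10) ^ 4 := by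
        have e1 : (n + 11) ^ 4 = (n + 11) ^ 2 * (n + 11) ^ 2 := by ring
        have e2 : (n + 10) ^ 4 = (n + 10) ^ 2 * (n + 10) ^ 2 := by ring
        rw [e1, e2]; nlinarith
      have h5 : 1000 * (n + 11) ^ 5 ≤ 1859 * (n + 10) ^ 5 := by
        have e1 : (n + 11) ^ 5 = (n + 11) ^ 4 * (n + 11) := by ring
        have e2 : (n + 10) ^ 5 = (n + 10) ^ 4 * (n + 10) := by ring
        rw [e1, e2]; nlinarith
      have : (n + 11) ^ 5 ≤ 2 * (n + 10) ^ 5 := by omega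
      simpa [Nat.add_right_comm] using this
    calc 54000 * (n + 1 + 10) ^ 5 ≤ 54000 * (2 * (n + 10) ^ 5) := Nat.mul_le_mul_left _ hstep
      _ = 2 * (54000 * (n + 10) ^ 5) := by ring
      _ ≤ 2 * 2 ^ (n + 33) := Nat.mul_le_mul_left _ ih
      _ = 2 ^ (n + 1 + 33) := by rw [show n + 1 + 33 = (n + 33) + 1 by omega, pow_succ]; ring

/-- The polynomial part of the precision inequality: `(T (s₀ + 2) + 2M + 3)(n + 10) ≤ 2^{n+33}`. [folklore] -/
theorem poly_le_two_pow (n : ℕ) : (Tdbl n * (s0 n + 2) + 2 * Mfin n + 3) * (n + 10) ≤ 2 ^ (n + 33) := by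
  refine le_trans ?_ (quintic_le_two_pow n)
  have h1 : Tdbl n * (s0 n + 2) + 2 * Mfin n + 3 ≤ 54000 * (n + 10) ^ 4 := by
    unfold s0 Mfin ResB Kb Gb
    rw [Tdbl_eq]
    nlinarith [sq_nonneg n, Nat.zero_le n]
  calc (Tdbl n * (s0 n + 2) + 2 * Mfin n + 3) * (n + 10) ≤ 54000 * (n + 10) ^ 4 * (n + 10) := Nat.mul_le_mul_right _ h1
    _ = 54000 * (n + 10) ^ 5 := by ring

/-- **The precision inequality**: `2^{a} (T 2^{T}(s₀ + 1) + T + 2M + 3)(n + 10) ≤ 2 · 2^{prec}`, i.e.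
`N (E_tot + 2η) ≤ 2` once `E_tot ≤ (T 2^T (s₀+1) + T + 2M + 1) η` (`Etot_le`) and `η ≤ (n + 10) 2^{−prec}`.
[cite: Jozsa2003, §9 Thm. 5 (accuracy of the accumulated distances)] -/
theorem prec_key (n : ℕ) :
    2 ^ aN n * (Tdbl n * 2 ^ Tdbl n * (s0 n + 1) + Tdbl n + 2 * Mfin n + 3) * (n + 10) ≤ 2 * 2 ^ precP n := by
  have h1 : Tdbl n * 2 ^ Tdbl n * (s0 n + 1) + Tdbl n + 2 * Mfin n + 3 ≤ 2 ^ Tdbl n * (Tdbl n * (s0 n + 2) + 2 * Mfin n + 3) := by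
    have : 1 ≤ 2 ^ Tdbl n := Nat.one_le_two_pow
    nlinarith
  have h2 := poly_le_two_pow n
  calc 2 ^ aN n * (Tdbl n * 2 ^ Tdbl n * (s0 n + 1) + Tdbl n + 2 * Mfin n + 3) * (n + 10)
      ≤ 2 ^ aN n * (2 ^ Tdbl n * (Tdbl n * (s0 n + 2) + 2 * Mfin n + 3)) * (n + 10) := by gcongr
    _ = 2 ^ aN n * 2 ^ Tdbl n * ((Tdbl n * (s0 n + 2) + 2 * Mfin n + 3) * (n + 10)) := by ring
    _ ≤ 2 ^ aN n * 2 ^ Tdbl n * 2 ^ (n + 33) := Nat.mul_le_mul_left _ h2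
    _ = 2 * 2 ^ precP n := by rw [← pow_succ', precP_eq, ← pow_add, ← pow_add]

/-! ### The size of the principal cycle -/

variable {D : ℕ}

/-- The minimal period of the step at a reduced quotient is at most the number of reduced quotients.
[cite: JacobsonWilliams2008, §3.3 Thm. 3.8] -/
theorem minimalPeriod_le_card_reducedSet (hD : ¬ IsSquare D) {x : QuadIrr D} (h : x.IsReduced) :
    Function.minimalPeriod step x ≤ (reducedSet D).card := by
  set N := (reducedSet D).card with hN
  have hmaps : ∀ i ∈ Finset.range (N + 1), step^[i] x ∈ reducedSet D :=
    fun i _ => mem_reducedSet_iff.mpr (isReduced_iterate hD h i)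
  have hcard : (reducedSet D).card < (Finset.range (N + 1)).card := by simp [hN]
  obtain ⟨i, hi, j, hj, hne, hij⟩ := Finset.exists_ne_map_eq_of_card_lt_of_maps_to hcard hmaps
  rw [Finset.mem_range] at hi hj
  wlog hlt : i < j generalizing i j
  · exact this j hj i hi hne.symm hij.symm (lt_of_le_of_ne (not_lt.mp hlt) hne.symm)
  have hper : step^[j - i] x = x := by
    have := iterate_cancel hD h i (j - i) 0 (by rw [Nat.add_sub_cancel' hlt.le, add_zero]; exact hij.symm)
    simpa using this
  have hp : Function.IsPeriodicPt step (j - i) x := hper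
  exact (hp.minimalPeriod_le (Nat.sub_pos_of_lt hlt)).trans (by omega)

/-- The number of reduced quotients is at most `⌊√D⌋ (2⌊√D⌋ + 1) ≤ 3D`. [cite: JacobsonWilliams2008, §3.3 (3.32)] -/
theorem card_reducedSet_le (D : ℕ) : (reducedSet D).card ≤ 3 * D := by
  classical
  unfold reducedSet
  refine (card_filter_le _ _).trans ((card_image_le).trans ?_)
  rw [card_product, Int.card_Icc, Int.card_Icc]
  simp only [add_sub_cancel_right]
  have hs : Nat.sqrt D * Nat.sqrt D ≤ D := by have := Nat.sqrt_le' D; rwa [sq] at this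
  have h1 : ((Nat.sqrt D : ℤ)).toNat = Nat.sqrt D := by simp
  have h2 : ((2 * (Nat.sqrt D : ℤ) + 1)).toNat = 2 * Nat.sqrt D + 1 := by
    rw [show (2 * (Nat.sqrt D : ℤ) + 1) = ((2 * Nat.sqrt D + 1 : ℕ) : ℤ) by push_cast; ring, Int.toNat_natCast]
  rw [h1, h2]
  have hsq : Nat.sqrt D ≤ D := Nat.sqrt_le_self D
  nlinarith

/-- **The principal cycle has at most `3D` ideals.** [cite: Jozsa2003, §6.3 Prop. 30] -/
theorem periodLength_le_three_mul (hD : ¬ IsSquare D) (hD4 : D % 4 = 0 ∨ D % 4 = 1) : periodLength D ≤ 3 * D :=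
  (minimalPeriod_le_card_reducedSet hD (isReduced_principalFirst hD hD4)).trans (card_reducedSet_le D)

/-- **The regulator is at most `3D (D + 1)`**: `p ≤ 3D` gaps, each `< ln(2√D) ≤ D + 1`.
[cite: Jozsa2003, §7 Prop. 31 (δ(I, ρI) < ln √D + ln 2)] -/
theorem log_fundUnit_lt (hD : ¬ IsSquare D) (hD4 : D % 4 = 0 ∨ D % 4 = 1) :
    Real.log (fundUnit D) < 3 * D * ((D : ℝ) + 1) + 1 := by
  rw [← pos_periodLength hD hD4, pos]
  have hgap : ∀ i, gap D i ≤ (D : ℝ) + 1 := by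
    intro i
    have h1 := gap_lt hD hD4 i
    have hD0 : (0 : ℝ) < D := by have := five_le hD hD4; positivity
    have h2 : Real.log (2 * Real.sqrt D) ≤ 2 * Real.sqrt D - 1 := by
      have := Real.log_le_sub_one_of_pos (show (0 : ℝ) < 2 * Real.sqrt D by positivity)
      linarith
    have h3 : 2 * Real.sqrt D ≤ (D : ℝ) + 1 := by
      nlinarith [Real.sq_sqrt hD0.le, sq_nonneg (Real.sqrt D - 1)]
    linarith
  calc ∑ j ∈ Finset.range (periodLength D), gap D j ≤ ∑ _j ∈ Finset.range (periodLength D), ((D : ℝ) + 1) :=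
        sum_le_sum fun i _ => hgap i
    _ = periodLength D * ((D : ℝ) + 1) := by rw [sum_const, card_range, nsmul_eq_mul]
    _ ≤ 3 * D * ((D : ℝ) + 1) := by
        have : (periodLength D : ℝ) ≤ 3 * D := by exact_mod_cast periodLength_le_three_mul hD hD4
        have : (0 : ℝ) ≤ (D : ℝ) + 1 := by positivity
        nlinarith
    _ < 3 * D * ((D : ℝ) + 1) + 1 := by linarith

/-- **The regulator exceeds `1/3`**: the first two gaps already sum to more than `ln 2`, and
`pos 2 ≤ 2R`. [cite: Jozsa2003, §7 Prop. 32 (δ(J, ρ²J) ≥ ln 2)] -/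
theorem log_fundUnit_gt_third (hD : ¬ IsSquare D) (hD4 : D % 4 = 0 ∨ D % 4 = 1) : 1 / 3 < Real.log (fundUnit D) := by
  have h2 := log_two_lt_gap_add_gap_succ hD hD4 0
  have hp2 : pos D 2 = gap D 0 + gap D 1 := by simp [pos, Finset.sum_range_succ]
  have hR : 2 * Real.log (fundUnit D) = pos D (2 * periodLength D) := by
    have := pos_add_mul_periodLength hD hD4 0 2
    simp only [zero_add, pos_zero] at this
    rw [this]; ring
  have hp := periodLength_pos hD hD4
  have hmono := pos_mono hD hD4 (show 2 ≤ 2 * periodLength D by omega)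
  have hlog2 : (2 : ℝ) / 3 < Real.log 2 := by
    have := Real.log_two_gt_d9; linarith
  linarith

end HallgrenQuantum

end Literature.Computability.Cryptography

end
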